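import Summits.QuantumFields.YangMills.Theorems.AllWindowsColdBoxBulkMidCollarExtension

/-!
# LINE-18 (crux `AllWindowsColdBox.BulkMidWindowSU2`, ⟨stmt-QuantumFields-24006⟩), toward the gauge-invariant flux maximum
# principle K3″: re-pinning the NORMAL links

Let `A` be an edge function that agrees with a datum `ϑ` on every TANGENTIAL shell edge of the enlarged box `Λ⁺ = {−1,…,2H+1}⁴`
(an edge with an extremal coordinate `−1` or `2H+1` off its own direction) and whose circulations over the plaquettes of `Λ⁺`
are `≤ C₁`; let the datum's circulations over the CORNER plaquettes (two normal links + two tangential shell edges at a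
boundary vertex of the cold box `{0,…,2H}⁴`) be `≤ ε`.  Then (`exists_repin`) there is an edge function `A₂` that agrees with
`ϑ` on EVERY pinned non-cold edge of `Λ⁺` (tangential shell edges AND normal links) with circulations `≤ 5C₁ + 4ε` over the
plaquettes of `Λ⁺`.  Construction: subtract the coboundary of one gauge value per cold-boundary vertex (the mismatch on a
chosen normal link), then overwrite the remaining normal links by the datum — each residual mismatch is a corner circulation
of `A − ϑ`.

Elementary.  HONEST LABEL: helper toward an UNREGISTERED internal obligation (K3″) of a critic-passed DRAFT line on the R2ξ″
RECORD-rung crux 24006; no stub, crux, rung or summit is proved here; the Yang–Mills mass gap is NOT proved by this file.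
-/

set_option autoImplicit false

noncomputable section

open Classical Function
open Literature.Probability.LatticeModels (Site)
open Literature.MathematicalPhysics.QuantumFieldTheory
open Literature.MathematicalPhysics.QuantumFieldTheory.LatticeMaxwell
open Literature.MathematicalPhysics.QuantumFieldTheory.AxialGauge
open Summit.QuantumFields.YangMills.Theorems.WeakCouplingRates

namespace Summit.QuantumFields.YangMills.Theorems.AllWindowsColdBoxBulkMidLine.FluxExt

variable (H : ℕ) (A ϑ : Literature.MathematicalPhysics.QuantumLattice.ZdEdge 4 → ℝ)

/-- Circulation is additive in the edge function. -/
theorem sCirc_sub_fun (B C : Literature.MathematicalPhysics.QuantumLattice.ZdEdge 4 → ℝ) (p : Plaq 4) :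
    sCirc (fun e => B e - C e) p = sCirc B p - sCirc C p := by
  simp only [sCirc]; ring

/-- One gauge value per boundary vertex `v` of the cold box: the mismatch `A − ϑ` on a chosen normal link at `v` (incoming from
`v − e_k` if the chosen extremal coordinate has `v_k = 0`, outgoing to `v + e_k` if `v_k = 2H`), signed so that subtracting its
coboundary re-pins that link; `0` at all other vertices. -/
def normPot (v : Site 4) : ℝ :=
  if h : (∀ m, 0 ≤ v m ∧ v m ≤ 2 * (H : ℤ)) ∧ (∃ k : Fin 4, v k = 0 ∨ v k = 2 * (H : ℤ)) then
    (if v h.2.choose = 0 then A (v - Pi.single h.2.choose 1, h.2.choose) - ϑ (v - Pi.single h.2.choose 1, h.2.choose)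
      else ϑ (v, h.2.choose) - A (v, h.2.choose))
  else 0

/-- The gauge-corrected field `A₁ = A − d(normPot)`. -/
def repin₁ : Literature.MathematicalPhysics.QuantumLattice.ZdEdge 4 → ℝ :=
  fun e => A e - (normPot H A ϑ (e.1 + Pi.single e.2 1) - normPot H A ϑ e.1)

/-- The re-pinned field: the datum on every pinned non-cold edge of the enlarged box, `A₁` elsewhere. -/
def repin : Literature.MathematicalPhysics.QuantumLattice.ZdEdge 4 → ℝ :=
  fun e => if e ∈ boxEdgesAt dirCorner (2 * H + 3) ∧ e ∉ boxEdges 4 (2 * H + 1) then ϑ e else repin₁ H A ϑ e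

variable {H A ϑ}

/-- Off the cold box the gauge value vanishes. -/
theorem normPot_eq_zero_of_not_cold {v : Site 4} (hv : ¬ ∀ m, 0 ≤ v m ∧ v m ≤ 2 * (H : ℤ)) : normPot H A ϑ v = 0 := by
  unfold normPot
  rw [dif_neg]
  exact fun h => hv h.1

/-- The gauge value at a boundary vertex of the cold box: the mismatch on SOME normal link at `v`, with its sign. -/
theorem normPot_spec {v : Site 4} (hv : ∀ m, 0 ≤ v m ∧ v m ≤ 2 * (H : ℤ)) (hex : ∃ k : Fin 4, v k = 0 ∨ v k = 2 * (H : ℤ)) :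
    ∃ k : Fin 4, (v k = 0 ∧ normPot H A ϑ v = A (v - Pi.single k 1, k) - ϑ (v - Pi.single k 1, k)) ∨
      (v k ≠ 0 ∧ v k = 2 * (H : ℤ) ∧ normPot H A ϑ v = ϑ (v, k) - A (v, k)) := by
  refine ⟨hex.choose, ?_⟩
  have hk := hex.choose_spec
  unfold normPot
  rw [dif_pos ⟨hv, hex⟩]
  by_cases h0 : v hex.choose = 0
  · exact Or.inl ⟨h0, by rw [if_pos h0]⟩
  · exact Or.inr ⟨h0, hk.resolve_left h0, by rw [if_neg h0]⟩

/-- The gauge correction does not change circulations. -/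
theorem sCirc_repin₁ (p : Plaq 4) : sCirc (repin₁ H A ϑ) p = sCirc A p := by
  have h := sCirc_coboundary_eq_zero (normPot H A ϑ) p
  have h2 := sCirc_sub_fun A (fun e => normPot H A ϑ (e.1 + Pi.single e.2 1) - normPot H A ϑ e.1) p
  change sCirc (fun e => A e - (normPot H A ϑ (e.1 + Pi.single e.2 1) - normPot H A ϑ e.1)) p = _
  rw [h2, h, sub_zero]

section Main

variable {C₁ ε : ℝ} (hH : 1 ≤ H) (hC : 0 ≤ C₁) (hε : 0 ≤ ε)
  (hA_tan : ∀ (y : Site 4) (i k : Fin 4), k ≠ i → (y k = -1 ∨ y k = 2 * (H : ℤ) + 1) → A (y, i) = ϑ (y, i))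
  (hA_flux : ∀ (y : Site 4) (i j : Fin 4), i ≠ j → (∀ m, -1 ≤ y m ∧ y m ≤ 2 * (H : ℤ) + 1) →
    y i ≤ 2 * (H : ℤ) → y j ≤ 2 * (H : ℤ) → |sCirc A (y, i, j)| ≤ C₁)
  (hcorner : ∀ (y : Site 4) (i j : Fin 4), i ≠ j → (y i = -1 ∨ y i = 2 * (H : ℤ)) → (y j = -1 ∨ y j = 2 * (H : ℤ)) →
    (∀ m, -1 ≤ y m ∧ y m ≤ 2 * (H : ℤ) + 1) → |sCirc ϑ (y, i, j)| ≤ ε)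

include hA_flux hcorner in
/-- The corner circulation of `A − ϑ` is at most `C₁ + ε`. -/
theorem abs_sCirc_sub_corner_le {y : Site 4} {i j : Fin 4} (hij : i ≠ j) (hyi : y i = -1 ∨ y i = 2 * (H : ℤ))
    (hyj : y j = -1 ∨ y j = 2 * (H : ℤ)) (hy : ∀ m, -1 ≤ y m ∧ y m ≤ 2 * (H : ℤ) + 1) :
    |sCirc A (y, i, j) - sCirc ϑ (y, i, j)| ≤ C₁ + ε :=
  (abs_sub _ _).trans (add_le_add (hA_flux y i j hij hy (by rcases hyi with h | h <;> omega)
    (by rcases hyj with h | h <;> omega)) (hcorner y i j hij hyi hyj hy))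

include hA_tan in
/-- Corner plaquette with both special coordinates at the bottom: the tangential edges are `(y,i)`, `(y,j)`. -/
theorem sCirc_sub_bb {y : Site 4} {i j : Fin 4} (hij : i ≠ j) (hyi : y i = -1) (hyj : y j = -1) :
    sCirc A (y, i, j) - sCirc ϑ (y, i, j) =
      (A (y + Pi.single i 1, j) - ϑ (y + Pi.single i 1, j)) - (A (y + Pi.single j 1, i) - ϑ (y + Pi.single j 1, i)) := by
  have h1 := hA_tan y i j hij.symm (Or.inl hyj)
  have h2 := hA_tan y j i hij (Or.inl hyi)
  simp only [sCirc]; rw [h1, h2]; ring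

include hA_tan in
/-- Corner plaquette with both special coordinates at the top: the tangential edges are the shifted ones. -/
theorem sCirc_sub_tt {y : Site 4} {i j : Fin 4} (hij : i ≠ j) (hyi : y i = 2 * (H : ℤ)) (hyj : y j = 2 * (H : ℤ)) :
    sCirc A (y, i, j) - sCirc ϑ (y, i, j) = (A (y, i) - ϑ (y, i)) - (A (y, j) - ϑ (y, j)) := by
  have h1 := hA_tan (y + Pi.single i 1) j i hij (Or.inr (by simp [hyi]))
  have h2 := hA_tan (y + Pi.single j 1) i j hij.symm (Or.inr (by simp [hyj]))
  simp only [sCirc]; rw [h1, h2]; ring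

include hA_tan in
/-- Mixed corner plaquette (`y_i = −1`, `y_j = 2H`): the normal links are `(y,i)` and `(y+e_i, j)`. -/
theorem sCirc_sub_bt {y : Site 4} {i j : Fin 4} (hij : i ≠ j) (hyi : y i = -1) (hyj : y j = 2 * (H : ℤ)) :
    sCirc A (y, i, j) - sCirc ϑ (y, i, j) = (A (y, i) - ϑ (y, i)) + (A (y + Pi.single i 1, j) - ϑ (y + Pi.single i 1, j)) := by
  have h1 := hA_tan (y + Pi.single j 1) i j hij.symm (Or.inr (by simp [hyj]))
  have h2 := hA_tan y j i hij (Or.inl hyi)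
  simp only [sCirc]; rw [h1, h2]; ring

include hH hC hε hA_tan hA_flux hcorner in
/-- **Inward normal link** `e = (y, i)` with `y_i = −1`, other coordinates in `[0, 2H]`: `|ϑ e − A₁ e| ≤ C₁ + ε`. -/
theorem abs_sub_repin₁_inward {y : Site 4} {i : Fin 4} (hyi : y i = -1) (hy : ∀ m, m ≠ i → 0 ≤ y m ∧ y m ≤ 2 * (H : ℤ)) :
    |ϑ (y, i) - repin₁ H A ϑ (y, i)| ≤ C₁ + ε := by
  have hvi : (y + Pi.single i (1 : ℤ) : Site 4) i = 0 := by simp [hyi]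
  have hvm : ∀ m, m ≠ i → (y + Pi.single i (1 : ℤ) : Site 4) m = y m := fun m hm => by simp [hm]
  have hvr : ∀ m, 0 ≤ (y + Pi.single i (1 : ℤ) : Site 4) m ∧ (y + Pi.single i (1 : ℤ) : Site 4) m ≤ 2 * (H : ℤ) := by
    intro m; by_cases hm : m = i
    · subst hm; rw [hvi]; constructor <;> omega
    · rw [hvm m hm]; exact hy m hm
  have hny : normPot H A ϑ y = 0 := normPot_eq_zero_of_not_cold (fun h => by have := (h i).1; omega)
  have hyr : ∀ m, -1 ≤ y m ∧ y m ≤ 2 * (H : ℤ) + 1 := by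
    intro m; by_cases hm : m = i
    · subst hm; omega
    · have := hy m hm; omega
  have hrep : repin₁ H A ϑ (y, i) = A (y, i) - normPot H A ϑ (y + Pi.single i 1) := by
    simp only [repin₁, hny, sub_zero]
  rw [hrep]
  obtain ⟨k₀, hk⟩ := normPot_spec (H := H) (A := A) (ϑ := ϑ) hvr ⟨i, Or.inl hvi⟩
  rcases hk with ⟨hk0, hnv⟩ | ⟨hkne, hk2, hnv⟩
  · by_cases hki : k₀ = i
    · -- the chosen link is `e` itself
      subst hki
      have hve : (y + Pi.single k₀ (1 : ℤ) : Site 4) - Pi.single k₀ 1 = y := by simp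
      rw [hnv, hve]
      have : ϑ (y, k₀) - (A (y, k₀) - (A (y, k₀) - ϑ (y, k₀))) = 0 := by ring
      rw [this, abs_zero]; positivity
    · -- bottom/bottom corner at `w = y − e_{k₀}`
      have hwi : (y - Pi.single k₀ (1 : ℤ) : Site 4) i = -1 := by simp [Ne.symm hki, hyi]
      have hwk : (y - Pi.single k₀ (1 : ℤ) : Site 4) k₀ = -1 := by
        have h0 : y k₀ = 0 := by rw [← hvm k₀ hki]; exact hk0
        simp [h0]
      have hwr : ∀ m, -1 ≤ (y - Pi.single k₀ (1 : ℤ) : Site 4) m ∧ (y - Pi.single k₀ (1 : ℤ) : Site 4) m ≤ 2 * (H : ℤ) + 1 := by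
        intro m; by_cases hm : m = k₀
        · subst hm; rw [hwk]; omega
        · simp [hm]; exact hyr m
      have hd := sCirc_sub_bb hA_tan (Ne.symm hki) hwi hwk
      have hb := abs_sCirc_sub_corner_le hA_flux hcorner (Ne.symm hki) (Or.inl hwi) (Or.inl hwk) hwr
      have e1 : (y - Pi.single k₀ (1 : ℤ) : Site 4) + Pi.single i 1 = y + Pi.single i 1 - Pi.single k₀ 1 := by abel
      have e2 : (y - Pi.single k₀ (1 : ℤ) : Site 4) + Pi.single k₀ 1 = y := by simp
      rw [e1, e2] at hd
      rw [hnv]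
      calc _ = |sCirc A (y - Pi.single k₀ 1, i, k₀) - sCirc ϑ (y - Pi.single k₀ 1, i, k₀)| := by rw [hd]; ring_nf
        _ ≤ C₁ + ε := hb
  · have hki : k₀ ≠ i := by rintro rfl; exact hkne hvi
    -- mixed corner at `y` with directions `(i, k₀)`
    have hyk : y k₀ = 2 * (H : ℤ) := by rw [← hvm k₀ hki]; exact hk2
    have hd := sCirc_sub_bt hA_tan (Ne.symm hki) hyi hyk
    have hb := abs_sCirc_sub_corner_le hA_flux hcorner (Ne.symm hki) (Or.inl hyi) (Or.inr hyk) hyr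
    rw [hnv]
    calc _ = |sCirc A (y, i, k₀) - sCirc ϑ (y, i, k₀)| := by rw [hd, abs_sub_comm]; ring_nf
      _ ≤ C₁ + ε := hb

include hH hC hε hA_tan hA_flux hcorner in
/-- **Outward normal link** `e = (y, i)` with `y_i = 2H`, all coordinates of `y` in `[0, 2H]`: `|ϑ e − A₁ e| ≤ C₁ + ε`. -/
theorem abs_sub_repin₁_outward {y : Site 4} {i : Fin 4} (hyi : y i = 2 * (H : ℤ)) (hy : ∀ m, 0 ≤ y m ∧ y m ≤ 2 * (H : ℤ)) :
    |ϑ (y, i) - repin₁ H A ϑ (y, i)| ≤ C₁ + ε := by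
  have hyr : ∀ m, -1 ≤ y m ∧ y m ≤ 2 * (H : ℤ) + 1 := fun m => by have := hy m; omega
  have hnv' : normPot H A ϑ (y + Pi.single i 1) = 0 :=
    normPot_eq_zero_of_not_cold (fun h => by have := (h i).2; simp [hyi] at this)
  have hrep : repin₁ H A ϑ (y, i) = A (y, i) + normPot H A ϑ y := by
    simp only [repin₁, hnv']; ring
  rw [hrep]
  obtain ⟨k₀, hk⟩ := normPot_spec (H := H) (A := A) (ϑ := ϑ) hy ⟨i, Or.inr hyi⟩
  rcases hk with ⟨hk0, hnv⟩ | ⟨hkne, hk2, hnv⟩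
  · have hki : k₀ ≠ i := by rintro rfl; omega
    -- mixed corner at `w = y − e_{k₀}` with directions `(k₀, i)`
    have hwk : (y - Pi.single k₀ (1 : ℤ) : Site 4) k₀ = -1 := by simp [hk0]
    have hwi : (y - Pi.single k₀ (1 : ℤ) : Site 4) i = 2 * (H : ℤ) := by simp [Ne.symm hki, hyi]
    have hwr : ∀ m, -1 ≤ (y - Pi.single k₀ (1 : ℤ) : Site 4) m ∧ (y - Pi.single k₀ (1 : ℤ) : Site 4) m ≤ 2 * (H : ℤ) + 1 := by
      intro m; by_cases hm : m = k₀
      · subst hm; rw [hwk]; omega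
      · simp [hm]; exact hyr m
    have hd := sCirc_sub_bt hA_tan hki hwk hwi
    have hb := abs_sCirc_sub_corner_le hA_flux hcorner hki (Or.inl hwk) (Or.inr hwi) hwr
    have e2 : (y - Pi.single k₀ (1 : ℤ) : Site 4) + Pi.single k₀ 1 = y := by simp
    rw [e2] at hd
    rw [hnv]
    calc _ = |sCirc A (y - Pi.single k₀ 1, k₀, i) - sCirc ϑ (y - Pi.single k₀ 1, k₀, i)| := by
          rw [hd, abs_sub_comm]; ring_nf
      _ ≤ C₁ + ε := hb
  · by_cases hki : k₀ = i
    · subst hki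
      rw [hnv]
      have : ϑ (y, k₀) - (A (y, k₀) + (ϑ (y, k₀) - A (y, k₀))) = 0 := by ring
      rw [this, abs_zero]; positivity
    · have hd := sCirc_sub_tt hA_tan (Ne.symm hki) hyi hk2
      have hb := abs_sCirc_sub_corner_le hA_flux hcorner (Ne.symm hki) (Or.inr hyi) (Or.inr hk2) hyr
      rw [hnv]
      calc _ = |sCirc A (y, i, k₀) - sCirc ϑ (y, i, k₀)| := by rw [hd, abs_sub_comm]; ring_nf
        _ ≤ C₁ + ε := hb

include hH hC hε hA_tan hA_flux hcorner in
/-- **Every pinned non-cold edge of the enlarged box is re-pinned up to `C₁ + ε` by `A₁`** (tangential shell edges exactly). -/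
theorem abs_sub_repin₁_le {e : Literature.MathematicalPhysics.QuantumLattice.ZdEdge 4}
    (hb : e ∈ boxEdgesAt dirCorner (2 * H + 3)) (hc : e ∉ boxEdges 4 (2 * H + 1)) :
    |ϑ e - repin₁ H A ϑ e| ≤ C₁ + ε := by
  obtain ⟨y, i⟩ := e
  obtain ⟨hyr, hyi⟩ := mem_dirBlock_iff.1 hb
  rw [mem_coldBoxEdges_iff] at hc
  by_cases hT : ∃ k : Fin 4, k ≠ i ∧ (y k = -1 ∨ y k = 2 * (H : ℤ) + 1)
  · obtain ⟨k, hki, hyk⟩ := hT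
    have h1 : normPot H A ϑ y = 0 :=
      normPot_eq_zero_of_not_cold (fun h => by have := h k; rcases hyk with h' | h' <;> omega)
    have hvk : (y + Pi.single i (1 : ℤ) : Site 4) k = y k := by simp [hki]
    have h2 : normPot H A ϑ (y + Pi.single i 1) = 0 :=
      normPot_eq_zero_of_not_cold (fun h => by have := h k; rw [hvk] at this; rcases hyk with h' | h' <;> omega)
    have : repin₁ H A ϑ (y, i) = ϑ (y, i) := by simp only [repin₁, h1, h2, sub_zero, hA_tan y i k hki hyk]
    rw [this, sub_self, abs_zero]; positivity
  · push Not at hT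
    have hother : ∀ m, m ≠ i → 0 ≤ y m ∧ y m ≤ 2 * (H : ℤ) := by
      intro m hm; have := hT m hm; have := hyr m; omega
    by_cases h1 : y i = -1
    · exact abs_sub_repin₁_inward hH hC hε hA_tan hA_flux hcorner h1 hother
    · by_cases h2 : y i = 2 * (H : ℤ)
      · refine abs_sub_repin₁_outward hH hC hε hA_tan hA_flux hcorner h2 fun m => ?_
        by_cases hm : m = i
        · subst hm; constructor <;> omega
        · exact hother m hm
      · exfalso; apply hc
        refine ⟨fun m => ?_, by have := hyr i; omega⟩
        by_cases hm : m = i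
        · subst hm; have := hyr m; constructor <;> omega
        · exact hother m hm

include hH hC hε hA_tan hA_flux hcorner in
/-- **Re-pinning the normal links.**  The field `repin H A ϑ` agrees with `ϑ` on every pinned non-cold edge of the enlarged box
and has circulations `≤ 5C₁ + 4ε` over the plaquettes of the enlarged box. -/
theorem repin_spec :
    (∀ e ∈ boxEdgesAt dirCorner (2 * H + 3), e ∉ boxEdges 4 (2 * H + 1) → repin H A ϑ e = ϑ e) ∧
    ∀ (y : Site 4) (i j : Fin 4), i ≠ j → (∀ m, -1 ≤ y m ∧ y m ≤ 2 * (H : ℤ) + 1) → y i ≤ 2 * (H : ℤ) →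
      y j ≤ 2 * (H : ℤ) → |sCirc (repin H A ϑ) (y, i, j)| ≤ 5 * C₁ + 4 * ε := by
  refine ⟨fun e hb hc => by simp only [repin, if_pos (And.intro hb hc)], fun y i j hij hy hyi hyj => ?_⟩
  have hδ : ∀ e : Literature.MathematicalPhysics.QuantumLattice.ZdEdge 4, |repin H A ϑ e - repin₁ H A ϑ e| ≤ C₁ + ε := by
    intro e
    by_cases h : e ∈ boxEdgesAt dirCorner (2 * H + 3) ∧ e ∉ boxEdges 4 (2 * H + 1)
    · simp only [repin, if_pos h]; exact abs_sub_repin₁_le hH hC hε hA_tan hA_flux hcorner h.1 h.2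
    · simp only [repin, if_neg h, sub_self, abs_zero]; positivity
  have hsplit : sCirc (repin H A ϑ) (y, i, j) = sCirc (repin₁ H A ϑ) (y, i, j) +
      ((repin H A ϑ (y, i) - repin₁ H A ϑ (y, i)) + (repin H A ϑ (y + Pi.single i 1, j) - repin₁ H A ϑ (y + Pi.single i 1, j)) -
        (repin H A ϑ (y + Pi.single j 1, i) - repin₁ H A ϑ (y + Pi.single j 1, i)) - (repin H A ϑ (y, j) - repin₁ H A ϑ (y, j))) := by
    simp only [sCirc]; ring
  rw [hsplit, sCirc_repin₁]
  have hA := hA_flux y i j hij hy hyi hyj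
  calc _ ≤ |sCirc A (y, i, j)| + |(repin H A ϑ (y, i) - repin₁ H A ϑ (y, i)) +
        (repin H A ϑ (y + Pi.single i 1, j) - repin₁ H A ϑ (y + Pi.single i 1, j)) -
        (repin H A ϑ (y + Pi.single j 1, i) - repin₁ H A ϑ (y + Pi.single j 1, i)) -
        (repin H A ϑ (y, j) - repin₁ H A ϑ (y, j))| := abs_add_le _ _
    _ ≤ C₁ + ((C₁ + ε) + (C₁ + ε) + (C₁ + ε) + (C₁ + ε)) := by
        refine add_le_add hA ?_
        refine (abs_sub _ _).trans (add_le_add ((abs_sub _ _).trans (add_le_add ((abs_add_le _ _).trans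
          (add_le_add (hδ _) (hδ _))) (hδ _))) (hδ _))
    _ = 5 * C₁ + 4 * ε := by ring

end Main

end Summit.QuantumFields.YangMills.Theorems.AllWindowsColdBoxBulkMidLine.FluxExt

end
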